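import Literature.Computability.AlgebraicComplexity.BLMW11ApproximationProjections
import Literature.Computability.AlgebraicComplexity.OrbitClosureProofs
import HarnessLib

/-!
# BLMW 2011 Prop. 9.3.2, second half of the proof: `(per_m) ∈ \overline{VP_ws}` forces small
border determinantal complexity (homogenised determinantal representations)

Bürgisser–Landsberg–Manivel–Weyman 2011, proof of Prop. 9.3.2 (arXiv:0907.2850, Prop. 9.2,
p. 21, "To show the other direction …"): if `\underline{L_ws}(per_m) < n`-ish then `per_m` is a
limit of polynomials `f_k` with `L_ws(f_k) < n`; "the universality of the determinant implies that
`f_k` is a projection of `det_n`, say `f_k(x) = det(M_k)` … We homogenize now with respect to an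
additional variable `ℓ` … `ℓ^{n-m} f_k(x) = ℓ^n f_k(x/ℓ) = det(M'_k)` with a matrix `M'_k` whose
entries are linear forms in `x_i` and `ℓ`. Since `GL_{n²}` is dense in `Mat_{n×n}`, … the form
`ℓ^{n-m} f_k` lies in the closure of `GL_{n²}·det_n`. As `lim f_k = per_m`, this implies that
`ℓ^{n-m} per_m` lies in the closure."

Formalisation (Zariski closure in coefficient space, the tree's `orbitClosure` /
`approxWsComplexity`):

* `homogenization_mem_endOrbit_detPoly` — for ANY `g` (not necessarily a form — the printed
  "sequence of forms `f_k`" is not needed) with an affine determinantal representation of size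
  `N`, the homogenisation `∑_{i ≤ N} ℓ^{N-i} g_i` (`g_i` the homogeneous components, `ℓ` any
  matrix variable, the variables of `g` placed anywhere among the `N²` matrix variables) lies in
  `End·det_N`: this is exactly the printed `ℓ^n f_k(x/ℓ) = det(M'_k)`; it generalises the tree's
  `X_pow_mul_rename_mem_endOrbit_detPoly` (homogeneous `g`), whose proof is followed line by line.
* `hasBorderDetRepr_of_coeffVec_perPoly_mem_zariskiClosure` — if `per_m` lies in the closure of a
  set of polynomials all having determinantal representations of size `N ≥ m`, then
  `ℓ^{N-m} per_m ∈ \overline{GL_{N²}·det_N}` (`HasBorderDetRepr ℂ m N`): transport the closure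
  along the LINEAR homogenisation map (`coeffVec_linearMap_mem_zariskiClosure`,
  `BLMW11ApproximationProjections.lean`) into `End·det_N ⊆ Δ[det_N]`
  (`endOrbit_subset_orbitClosure_holds`, the printed density of `GL_{n²}` in `Mat_{n×n}`).
* `hasBorderDetRepr_of_approxWsComplexity_le` — the printed direction, with the universality of
  the determinant for weakly-skew circuits as an explicit hypothesis `huniv`
  (`L_ws(g) ≤ r ⇒ dc(g) ≤ N`);
* `hasDetRepr_of_wsComplexity_le_of_skew_le_ws` — that universality from conjunct (iii) of
  `BLMW2011_sec9_detVPws` ("weakly skew ⇒ skew, linear size factor", [koka:08]) and the tree's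
  skew universality `HI16Skew.isProjection_detPoly_of_isSkew` (Malod–Portier 2008, Lemma 6);
* `not_isVPwsBarFamily_perPoly_of_skew_le_ws` — **`(iii)` ⇒ (Mulmuley–Sohoni "no constant c"
  conjecture `BorderDcPerSuperpolynomial` ⇒ `(per_m) ∉ \overline{VP_ws}`)**, i.e. one direction of
  the first equivalence of Prop. 9.3.2, modulo conjunct (iii) (in flight in cell `val-lit`).

Theorems only (no definitions, no named facts); cell `val-lit`, seat t14, step (P2) of the
discharge of `BLMW2011_prop_9_3_2`.

## References
* [BLMW 2011] SIAM J. Comput. 40 (2011), Prop. 9.3.2 and its proof (arXiv Prop. 9.2, p. 21).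
  Bib key `BurgisserEtAl2011`.
* [MS 2001] K. Mulmuley, M. Sohoni, GCT I, SIAM J. Comput. 31 (2001), Prop. 4.4 (homogenising a
  determinantal representation). Bib key `MulmuleySohoniSIAM2001`.
-/

open MvPolynomial

namespace Literature.Computability.AlgebraicComplexity

/-! ### Homogenised determinantal representations lie in `End · det_N` -/

section Homogenize

variable {k : Type*} [Field k]

/-- All homogeneous components up to any bound `N ≥ deg g` sum to `g`. [cite: BurgisserEtAl2011, §9.3 (proof of Prop. 9.3.2, homogenisation)] -/
theorem sum_homogeneousComponent_range_of_totalDegree_le {σ : Type*} (g : MvPolynomial σ k)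
    {N : ℕ} (hN : g.totalDegree ≤ N) :
    ∑ i ∈ Finset.range (N + 1), homogeneousComponent i g = g := by
  rw [← Finset.sum_subset (Finset.range_subset_range.mpr (Nat.succ_le_succ hN))
    (fun n hn hn' => by
      apply homogeneousComponent_eq_zero
      rw [Finset.mem_range] at hn hn'
      omega)]
  exact sum_homogeneousComponent g

/-- Evaluation of the homogenisation `∑_{i ≤ N} ℓ^{N-i} g_i(X_ι)` at a point `x` with
`x_ℓ ≠ 0`: it equals `x_ℓ^N · g(x_ι / x_ℓ)` (the printed `ℓ^n f(x/ℓ)`), for `deg g ≤ N`.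
[cite: BurgisserEtAl2011, §9.3 (proof of Prop. 9.3.2, homogenisation)] -/
theorem eval_homogenization_eq {τ ρ : Type*} (g : MvPolynomial τ k) {N : ℕ}
    (hN : g.totalDegree ≤ N) (ι : τ → ρ) (y : ρ) (x : ρ → k) (hx : x y ≠ 0) :
    eval x (∑ i ∈ Finset.range (N + 1), X y ^ (N - i) * rename ι (homogeneousComponent i g)) =
      x y ^ N * eval (fun t => x (ι t) / x y) g := by
  have hscale : (x ∘ ι) = x y • (fun t => x (ι t) / x y) := by
    funext t
    simp only [Function.comp_apply, Pi.smul_apply, smul_eq_mul]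
    field_simp
  rw [map_sum]
  conv_rhs => rw [← sum_homogeneousComponent_range_of_totalDegree_le g hN, map_sum,
    Finset.mul_sum]
  refine Finset.sum_congr rfl fun i hi => ?_
  rw [Finset.mem_range] at hi
  rw [map_mul, map_pow, eval_X, eval_rename, hscale,
    eval_smul_of_isHomogeneous (homogeneousComponent_isHomogeneous i g), ← mul_assoc, ← pow_add]
  congr 2
  omega

/-- **Homogenised determinantal representations lie in the endomorphism orbit of `det_N`**
(BLMW 2011, proof of Prop. 9.3.2: "`ℓ^{n-m} f_k(x) = ℓ^n f_k(x/ℓ) = det(M'_k)` with a matrix `M'_k`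
whose entries are linear forms in `x_i` and `ℓ`"; Mulmuley–Sohoni 2001, Prop. 4.4). For every
polynomial `g` — homogeneous or not — with an affine determinantal representation of size `N`,
every placement `ι` of its variables among the `N²` matrix variables and every matrix variable
`X_y`, the homogenisation `∑_{i ≤ N} X_y^{N-i} · g_i(X_ι)` (`g_i` = degree-`i` component; note
`deg g ≤ N`, `totalDegree_le_of_hasDetRepr_holds`) is a linear-substitution instance of `det_N`:
homogenise the affine entries with `X_y`; the two sides agree wherever `x_y ≠ 0`
(`eval_homogenization_eq`), hence everywhere (`k` infinite). Generalises
`X_pow_mul_rename_mem_endOrbit_detPoly` (the case of a form `g`), whose proof is followed.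
[cite: BurgisserEtAl2011, §9.3 (proof of Prop. 9.3.2, homogenisation)] -/
theorem homogenization_mem_endOrbit_detPoly [Infinite k] {τ : Type*} [Fintype τ] [DecidableEq τ]
    {g : MvPolynomial τ k} {N : ℕ} (hA : HasDetRepr g N) (ι : τ → Fin N × Fin N)
    (y : Fin N × Fin N) :
    (∑ i ∈ Finset.range (N + 1), X y ^ (N - i) * rename ι (homogeneousComponent i g)) ∈
      endOrbit (Fin N × Fin N) k (detPoly (Fin N) k) := by
  classical
  have hdeg : g.totalDegree ≤ N := totalDegree_le_of_hasDetRepr_holds hA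
  obtain ⟨A, hAdeg, hAdet⟩ := hA
  -- the homogenising substitution matrix (as in `X_pow_mul_rename_mem_endOrbit_detPoly`)
  set M : Matrix (Fin N × Fin N) (Fin N × Fin N) k := fun p ij =>
    (if p = y then coeff 0 (A ij.1 ij.2) else 0) +
      ∑ t, if p = ι t then coeff (Finsupp.single t 1) (A ij.1 ij.2) else 0 with hM
  refine ⟨M, ?_⟩
  -- values of the substituted entries where `x y ≠ 0`
  have hentry : ∀ (x : Fin N × Fin N → k), x y ≠ 0 → ∀ i j : Fin N,
      eval x (linSubst _ k M (X (i, j))) = x y * eval (fun t => x (ι t) / x y) (A i j) := by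
    intro x hx i j
    rw [linSubst_X, map_sum, eval_eq_of_totalDegree_le_one (hAdeg i j)]
    simp only [smul_eval, eval_X, hM, add_mul, Finset.sum_add_distrib, Finset.sum_mul, ite_mul,
      zero_mul]
    rw [Finset.sum_comm]
    simp only [mul_add, Finset.mul_sum]
    congr 1
    · rw [Finset.sum_ite_eq' Finset.univ y, if_pos (Finset.mem_univ _)]
      ring
    · refine Finset.sum_congr rfl fun t _ => ?_
      rw [Finset.sum_ite_eq' Finset.univ (ι t), if_pos (Finset.mem_univ _)]
      field_simp
  -- values of the substituted determinant where `x y ≠ 0`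
  have hdet : ∀ (x : Fin N × Fin N → k), x y ≠ 0 →
      eval x (linSubst _ k M (detPoly (Fin N) k)) =
        x y ^ N * eval (fun t => x (ι t) / x y) g := by
    intro x hx
    have hmat : ((Matrix.mvPolynomialX (Fin N) (Fin N) k).map (linSubst _ k M)).map (eval x) =
        x y • A.map (eval fun t => x (ι t) / x y) := by
      ext i j
      simp only [Matrix.map_apply, Matrix.mvPolynomialX_apply, Matrix.smul_apply, smul_eq_mul]
      exact hentry x hx i j
    rw [detPoly, AlgHom.map_det, RingHom.map_det, AlgHom.mapMatrix_apply, RingHom.mapMatrix_apply,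
      hmat, Matrix.det_smul, Fintype.card_fin, ← RingHom.mapMatrix_apply, ← RingHom.map_det, hAdet]
  -- the two polynomials agree where `x y ≠ 0`, hence everywhere
  have hprod : (linSubst _ k M (detPoly (Fin N) k) -
      ∑ i ∈ Finset.range (N + 1), X y ^ (N - i) * rename ι (homogeneousComponent i g)) * X y =
        0 := by
    apply MvPolynomial.funext
    intro x
    rw [map_mul, map_sub, map_zero, eval_X]
    by_cases hx : x y = 0
    · rw [hx, mul_zero]
    · rw [hdet x hx, eval_homogenization_eq g hdeg ι y x hx, sub_self, zero_mul]
  have hX : (X y : MvPolynomial (Fin N × Fin N) k) ≠ 0 := X_ne_zero y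
  exact (sub_eq_zero.mp ((mul_eq_zero.mp hprod).resolve_right hX))

end Homogenize

/-! ### From `per_m ∈ closure{dc ≤ N}` to `ℓ^{N-m} per_m ∈ Δ[det_N]` -/

section PerClosure

/-- **BLMW 2011, proof of Prop. 9.3.2 (second direction), closure step.** If `per_m` (as a point of
coefficient space) lies in the Zariski closure of a set `S` of polynomials in the `m²` variables
each admitting an affine determinantal representation of size `N ≥ m`, then
`X₀₀^{N-m} per_m ∈ \overline{GL_{N²}·det_N}`, i.e. `HasBorderDetRepr ℂ m N`. Proof: the
homogenisation map `H(g) = ∑_{i ≤ N} X₀₀^{N-i} g_i(X_block)` is LINEAR and `S` has bounded degree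
(`≤ N`), so `H(per_m)` lies in the closure of `H(S)` (`coeffVec_linearMap_mem_zariskiClosure`);
`H(S) ⊆ End·det_N ⊆ Δ[det_N]` (`homogenization_mem_endOrbit_detPoly`,
`endOrbit_subset_orbitClosure_holds` — the printed "`GL_{n²}` is dense in `Mat_{n×n}`"), and
`Δ[det_N]` is closed; finally `H(per_m) = X₀₀^{N-m} per_m` placed in the bottom-right block
(`paddedPerPoly`), `per_m` being a form of degree `m`.
[cite: BurgisserEtAl2011, Prop. 9.3.2 (proof, second direction)] -/
theorem hasBorderDetRepr_of_coeffVec_perPoly_mem_zariskiClosure {m N : ℕ} [NeZero N]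
    (hmN : m ≤ N) {S : Set (MvPolynomial (Fin m × Fin m) ℂ)} (hS : ∀ g ∈ S, HasDetRepr g N)
    (h : coeffVec (perPoly (Fin m) ℂ) ∈ zariskiClosure (coeffVec '' S)) :
    HasBorderDetRepr ℂ m N := by
  classical
  -- block placement of the variables of `per_m`
  set e : Fin m ≃ BlockIdx m N := (Fintype.equivFinOfCardEq (card_blockIdx hmN)).symm with he
  set ι : Fin m × Fin m → Fin N × Fin N := fun ij => ((e ij.1 : Fin N), (e ij.2 : Fin N)) with hι
  set y : Fin N × Fin N := (0, 0) with hy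
  -- the linear homogenisation map
  set L : MvPolynomial (Fin m × Fin m) ℂ →ₗ[ℂ] MvPolynomial (Fin N × Fin N) ℂ :=
    ∑ i ∈ Finset.range (N + 1), LinearMap.mulLeft ℂ (X y ^ (N - i)) ∘ₗ
      ((rename ι : MvPolynomial (Fin m × Fin m) ℂ →ₐ[ℂ] _).toLinearMap ∘ₗ homogeneousComponent i)
    with hL
  have hLapply : ∀ g : MvPolynomial (Fin m × Fin m) ℂ,
      L g = ∑ i ∈ Finset.range (N + 1), X y ^ (N - i) * rename ι (homogeneousComponent i g) := by
    intro g
    simp only [hL, LinearMap.sum_apply, LinearMap.comp_apply, LinearMap.mulLeft_apply,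
      AlgHom.toLinearMap_apply]
  -- bounded supports on `S`
  have hSB : ∀ g ∈ S, g.support ⊆ (Finset.range (N + 1)).biUnion
      (fun n => (Finset.univ : Finset (Fin m × Fin m)).finsuppAntidiag n) :=
    fun g hg => support_subset_degBox_of_totalDegree_le (totalDegree_le_of_hasDetRepr_holds (hS g hg))
  -- transport the closure along `L`
  have hLper := coeffVec_linearMap_mem_zariskiClosure L hSB h
  -- `L '' S ⊆ Δ[det_N]`
  have hLS : coeffVec '' (L '' S) ⊆
      zariskiClosure (coeffVec '' glOrbit (Fin N × Fin N) ℂ (detPoly (Fin N) ℂ)) := by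
    rintro _ ⟨_, ⟨g, hg, rfl⟩, rfl⟩
    have hmem : L g ∈ orbitClosure (detPoly (Fin N) ℂ) := by
      rw [hLapply]
      exact endOrbit_subset_orbitClosure_holds _ (homogenization_mem_endOrbit_detPoly (hS g hg) ι y)
    exact hmem
  have hclosed := zariskiClosure_image_subset_of_subset hLS hLper
  -- `L per_m = paddedPerPoly ℂ m N`
  have hper : (perPoly (Fin m) ℂ).IsHomogeneous m := by
    simpa using (perPoly_isHomogeneous (n := Fin m) (k := ℂ))
  have hLperm : L (perPoly (Fin m) ℂ) = paddedPerPoly ℂ m N := by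
    rw [hLapply]
    have hcomp : ∀ i ∈ Finset.range (N + 1),
        X y ^ (N - i) * rename ι (homogeneousComponent i (perPoly (Fin m) ℂ)) =
          if i = m then X y ^ (N - m) * rename ι (perPoly (Fin m) ℂ) else 0 := by
      intro i _
      rw [homogeneousComponent_of_mem hper]
      split_ifs with him
      · subst him; rfl
      · simp
    rw [Finset.sum_congr rfl hcomp, Finset.sum_ite_eq' (Finset.range (N + 1)) m,
      if_pos (Finset.mem_range.mpr (Nat.lt_succ_of_le hmN))]
    rw [paddedPerPoly, ← rename_perPoly_equiv e, rename_rename]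
    rfl
  have : paddedPerPoly ℂ m N ∈ orbitClosure (detPoly (Fin N) ℂ) := by
    rw [← hLperm]
    exact hclosed
  exact this

/-- **BLMW 2011, Prop. 9.3.2, direction "`(per_m) ∈ \overline{VP_ws}` ⇒ ¬(MS)", pointwise form,
with the universality of the determinant for weakly-skew circuits as a hypothesis**: if every
polynomial `g` in the variables of `per_m` with `L_ws(g) ≤ r` has `dc(g) ≤ N` (`N ≥ m`) and
`\underline{L_ws}(per_m) ≤ r`, then `X₀₀^{N-m} per_m ∈ \overline{GL_{N²}·det_N}`.
[cite: BurgisserEtAl2011, Prop. 9.3.2 (proof, second direction)] -/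
theorem hasBorderDetRepr_of_approxWsComplexity_le {m r N : ℕ} [NeZero N] (hmN : m ≤ N)
    (huniv : ∀ g : MvPolynomial (Fin m × Fin m) ℂ, wsComplexity g ≤ r → HasDetRepr g N)
    (h : approxWsComplexity (perPoly (Fin m) ℂ) ≤ r) : HasBorderDetRepr ℂ m N :=
  hasBorderDetRepr_of_coeffVec_perPoly_mem_zariskiClosure hmN
    (S := {g : MvPolynomial (Fin m × Fin m) ℂ |
      wsComplexity g ≤ approxWsComplexity (perPoly (Fin m) ℂ)})
    (fun g hg => huniv g (le_trans hg h)) (coeffVec_mem_zariskiClosure_approxWsComplexity _)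

end PerClosure

/-! ### The universality step from conjunct (iii) of `BLMW2011_sec9_detVPws` -/

section Universality

/-- **Universality of the determinant for weakly-skew circuits, from (iii)** (BLMW 2011 §9.2,
"if `L_ws(f) ≤ m` then `f` is a projection of `det_{m+1}`", here through skew circuits): if skew
circuits simulate weakly-skew ones with linear size factor `c` (conjunct (iii) of
`BLMW2011_sec9_detVPws`, [koka:08]), then `L_ws(g) ≤ r ⇒ dc(g) ≤ 3cr + 1`, by the skew
universality `HI16Skew.isProjection_detPoly_of_isSkew` (Malod–Portier 2008, Lemma 6) at a
size-optimal well-formed skew circuit and `HasDetRepr.of_isProjection_holds`.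
[cite: BurgisserEtAl2011, §9.2 (universality of the determinant)] -/
theorem hasDetRepr_of_wsComplexity_le_of_skew_le_ws {k : Type*} [CommRing k] (c : ℕ)
    (hc : ∀ {σ : Type} [Fintype σ] (f : MvPolynomial σ k), skewComplexity f ≤ c * wsComplexity f)
    {σ : Type} [Fintype σ] (g : MvPolynomial σ k) {r : ℕ} (hg : wsComplexity g ≤ r) :
    HasDetRepr g (3 * (c * r) + 1) := by
  classical
  obtain ⟨P, _, h2, hsk, hcomp, hsz⟩ := HI16Skew.skewComplexity_attained g
  have hproj := HI16Skew.isProjection_detPoly_of_isSkew P h2 hsk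
  rw [ArithCircuit.Computes] at hcomp
  rw [hcomp] at hproj
  have hrepr : HasDetRepr g (3 * P.size + 1) :=
    HasDetRepr.of_isProjection_holds (hasDetRepr_detPoly _) hproj
  refine HasDetRepr.mono_holds hrepr ?_
  have : P.size ≤ c * r := by
    rw [hsz]
    exact (hc g).trans (Nat.mul_le_mul_left c hg)
  omega

/-- **BLMW 2011, Prop. 9.3.2 — first equivalence, direction "(MS) ⇒ `(per_m) ∉ \overline{VP_ws}`",
modulo conjunct (iii) of `BLMW2011_sec9_detVPws`.** If skew circuits simulate weakly-skew ones with
a linear size factor ([koka:08]; in flight in cell `val-lit`), then the Mulmuley–Sohoni conjecture in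
its "no constant `c`" form (`BorderDcPerSuperpolynomial`, BLMW Conj. 1.1) implies that the
permanent family is not in `\overline{VP_ws}`. Contrapositive of the printed second direction: a
polynomial bound `\underline{L_ws}(per_m) ≤ m^a + a` gives, for every `m`,
`X₀₀^{N-m} per_m ∈ Δ[det_N]` with `N = m + 3c(m^a + a) + 1` p-bounded
(`hasBorderDetRepr_of_approxWsComplexity_le` + `hasDetRepr_of_wsComplexity_le_of_skew_le_ws`).
[cite: BurgisserEtAl2011, Prop. 9.3.2] -/
theorem not_isVPwsBarFamily_perPoly_of_skew_le_ws
    (h3 : ∃ c : ℕ, ∀ {σ : Type} [Fintype σ] (f : MvPolynomial σ ℂ),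
      skewComplexity f ≤ c * wsComplexity f)
    (hMS : BorderDcPerSuperpolynomial) :
    ¬ IsVPwsBarFamily (fun m => perPoly (Fin m) ℂ) := by
  intro hbar
  obtain ⟨c, hc⟩ := h3
  obtain ⟨a, ha⟩ := hbar
  -- the size function
  set Nf : ℕ → ℕ := fun n => n + 3 * (c * (n ^ a + a)) with hNf
  have hNp : IsPBounded fun n => Nf n + 1 :=
    IsPBounded.add_holds (IsPBounded.add_holds IsPBounded.id
      (IsPBounded.mul_holds (IsPBounded.const 3) (IsPBounded.mul_holds (IsPBounded.const c)
        (IsPBounded.add_holds (IsPBounded.pow_holds IsPBounded.id a) (IsPBounded.const a)))))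
      (IsPBounded.const 1)
  obtain ⟨c', hc'⟩ := hNp
  apply hMS
  have hNfn : ∀ n, Nf n = n + 3 * (c * (n ^ a + a)) := fun n => rfl
  refine ⟨c', fun n => ⟨Nf n + 1, inferInstance, by rw [hNfn]; omega, hc' n, ?_⟩⟩
  refine hasBorderDetRepr_of_approxWsComplexity_le (r := n ^ a + a) (by rw [hNfn]; omega) ?_ (ha n)
  intro g hg
  refine HasDetRepr.mono_holds (hasDetRepr_of_wsComplexity_le_of_skew_le_ws c hc g hg) ?_
  rw [hNfn]
  omega

/-- The same, with the whole fact `BLMW2011_sec9_detVPws` as hypothesis (its conjunct (iii) is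
used). [cite: BurgisserEtAl2011, Prop. 9.3.2] -/
theorem not_isVPwsBarFamily_perPoly_of_sec9_detVPws (h : BLMW2011_sec9_detVPws)
    (hMS : BorderDcPerSuperpolynomial) :
    ¬ IsVPwsBarFamily (fun m => perPoly (Fin m) ℂ) :=
  not_isVPwsBarFamily_perPoly_of_skew_le_ws h.2.2 hMS

end Universality

end Literature.Computability.AlgebraicComplexity
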